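import Mathlib.Analysis.Analytic.IsolatedZeros
import Mathlib.Analysis.Analytic.Constructions
import Mathlib.Analysis.SpecificLimits.Basic
import Mathlib.Analysis.SpecialFunctions.Pow.Real
import Mathlib.Analysis.Complex.Basic
import HarnessLib

/-!
# Rigidity of cusp hits on geometric abscissae (Lucas second differences)

Format (Runge / Pólya / Schneider-type counting problems): a "jet + tail" function
`h(N) = A(N) + g(1/N)` with a polynomial jet `A` and a tail `g` analytic at `0`, `g 0 = 0`; a HIT is an
`N ∈ ℕ` with `h(N) ∈ ℤ`. For TRANSCENDENTAL (even: non-zero) tails one expects the hit set to be very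
sparse, and every structured log-dense candidate set of abscissae must be excluded. This file does so
for GEOMETRIC progressions, with a linear jet, by an elementary argument we could not find in print
(it is the integer-coefficient "Lucas second difference" trick; folklore in spirit):

* `eventually_zero_of_frequently_geometric_hits`: let `c ≥ 2`, `λ ≥ 1` be integers, `α, α₀ ∈ ℂ` (ANY
  linear jet, not necessarily real or rational), `g` analytic at `0` with `g 0 = 0`. If for infinitely
  many `m` the THREE numbers `λc^m, λc^{m+1}, λc^{m+2}` are all hits of `αN + α₀ + g(1/N)`, then
  `g ≡ 0` near `0`.
  Proof: `Ξ(z) := c·g(z) − (1 + c)·g(z/c) + g(z/c²)` (coefficients = those of `(T − 1)(T − c)`, the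
  integer polynomial killing the polar and constant monomials) is analytic at `0`, vanishes at `0`, and
  at `z = 1/(λc^m)` equals the INTEGER `cL₀ − (1 + c)L₁ + L₂` (the jet cancels exactly); integers
  tending to `0` vanish, so `Ξ ≡ 0` (identity theorem); writing `g = zⁿ·u`, `u(0) ≠ 0`, `n ≥ 1`, the
  identity forces `c − (1 + c)c^{-n} + c^{-2n} = 0`, i.e. `c^{2n+1} + 1 = cⁿ + c^{n+1}`, impossible.
* Consequence (`geometric_hits_no_threeAP` form): the hit set of a NON-ZERO tail with a linear jet
  contains only finitely many exponent-triples `{m, m+1, m+2}` along any `λ·c^ℕ`; applied to `c = b^p`,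
  `λ = b^s` this says the exponents `{m : b^m hit}` contain no 3-term arithmetic progression of any fixed
  common difference `p` beyond finitely many — so by Roth's theorem that exponent set has upper density
  `0`: geometric abscissae cannot carry a positive proportion of the hits of a non-trivial tail.

The same trick with `Λ(T) = (T − 1)∏(T² − L_{pk}T + 1)` (Lucas numbers `L_j = θ^j + θ^{-j}`) handles
Pell/Lucas abscissae and higher-order jets (there the conclusion is "the tail is algebraic", the
Laurent-polynomial solutions being genuine); not formalised here.
-/

namespace Literature.NumberTheory.Transcendental

open Filter
open _root_.Topology

noncomputable section

/-- The geometric (Lucas) second difference of a tail at an integer ratio `c`: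
`Ξ_c g z = c·g z − (1 + c)·g(z/c) + g(z/c²)` — the coefficients of `(T − 1)(T − c)` applied to the
rescalings `z ↦ z/cʳ`. [folklore] -/
def geomSecondDiff (c : ℂ) (g : ℂ → ℂ) : ℂ → ℂ :=
  fun z => c * g z - (1 + c) * g (z / c) + g (z / c ^ 2)

/-- Rescaling preserves analyticity at `0`. [folklore] -/
theorem analyticAt_comp_div_const {g : ℂ → ℂ} (hg : AnalyticAt ℂ g 0) (c : ℂ) :
    AnalyticAt ℂ (fun z => g (z / c)) 0 := by
  have h1 : AnalyticAt ℂ (fun z : ℂ => z / c) 0 := by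
    simp_rw [div_eq_mul_inv]
    exact analyticAt_id.mul analyticAt_const
  exact hg.comp_of_eq h1 (by simp)

/-- `Ξ_c g` is analytic at `0`. [folklore] -/
theorem analyticAt_geomSecondDiff (c : ℂ) {g : ℂ → ℂ} (hg : AnalyticAt ℂ g 0) :
    AnalyticAt ℂ (geomSecondDiff c g) 0 := by
  unfold geomSecondDiff
  exact ((analyticAt_const.mul hg).sub (analyticAt_const.mul (analyticAt_comp_div_const hg c))).add
    (analyticAt_comp_div_const hg (c ^ 2))

/-- `Ξ_c g 0 = 0` when `g 0 = 0`. [folklore] -/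
theorem geomSecondDiff_zero (c : ℂ) {g : ℂ → ℂ} (hg0 : g 0 = 0) : geomSecondDiff c g 0 = 0 := by
  simp [geomSecondDiff, hg0]

/-- The sample points `1/(λcᵐ)` tend to `0` within `{0}ᶜ` (`c ≥ 2`, `λ ≥ 1`). [folklore] -/
theorem tendsto_inv_geometric {c lam : ℕ} (hc : 2 ≤ c) (hlam : 1 ≤ lam) :
    Tendsto (fun m : ℕ => (((lam * c ^ m : ℕ) : ℂ))⁻¹) atTop (𝓝[≠] 0) := by
  have hc1 : (1 : ℝ) < c := by exact_mod_cast (lt_of_lt_of_le one_lt_two hc)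
  have hlam0 : (0 : ℝ) < lam := by exact_mod_cast hlam
  have h1 : Tendsto (fun m : ℕ => (lam : ℝ) * (c : ℝ) ^ m) atTop atTop :=
    (tendsto_pow_atTop_atTop_of_one_lt hc1).const_mul_atTop hlam0
  have h2 : Tendsto (fun m : ℕ => (((lam * c ^ m : ℕ) : ℂ))⁻¹) atTop (𝓝 0) := by
    have h3 := (Complex.continuous_ofReal.tendsto 0).comp h1.inv_tendsto_atTop
    rw [Complex.ofReal_zero] at h3
    refine Tendsto.congr (fun m => ?_) h3
    simp only [Function.comp_apply, Pi.inv_apply, Complex.ofReal_inv]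
    push_cast
    ring
  refine tendsto_nhdsWithin_iff.mpr ⟨h2, Eventually.of_forall fun m => ?_⟩
  have : ((lam * c ^ m : ℕ) : ℂ) ≠ 0 := by
    have hpos : 0 < lam * c ^ m := Nat.mul_pos (by omega) (pow_pos (by omega) m)
    exact_mod_cast hpos.ne'
  exact inv_ne_zero this

/-- **The jet cancels**: if `λcᵐ⁺ʳ` is a hit with integer `Lᵣ` for `r = 0, 1, 2`, then
`Ξ_c g (1/(λcᵐ)) = cL₀ − (1 + c)L₁ + L₂ ∈ ℤ`. [folklore] -/
theorem geomSecondDiff_sample_eq_int {c lam : ℕ} (hc : 2 ≤ c) (hlam : 1 ≤ lam) (α α₀ : ℂ)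
    (g : ℂ → ℂ) (m : ℕ) (L₀ L₁ L₂ : ℤ)
    (h0 : α * ((lam * c ^ m : ℕ) : ℂ) + α₀ + g (((lam * c ^ m : ℕ) : ℂ))⁻¹ = L₀)
    (h1 : α * ((lam * c ^ (m + 1) : ℕ) : ℂ) + α₀ + g (((lam * c ^ (m + 1) : ℕ) : ℂ))⁻¹ = L₁)
    (h2 : α * ((lam * c ^ (m + 2) : ℕ) : ℂ) + α₀ + g (((lam * c ^ (m + 2) : ℕ) : ℂ))⁻¹ = L₂) :
    geomSecondDiff (c : ℂ) g ((((lam * c ^ m : ℕ) : ℂ))⁻¹) =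
      (((c : ℤ) * L₀ - (1 + c) * L₁ + L₂ : ℤ) : ℂ) := by
  have hc0 : (c : ℂ) ≠ 0 := by exact_mod_cast (show c ≠ 0 by omega)
  have hlam0 : (lam : ℂ) ≠ 0 := by exact_mod_cast (show lam ≠ 0 by omega)
  have hcm : ((c : ℂ) ^ m) ≠ 0 := pow_ne_zero _ hc0
  -- the two rescaled sample points
  have e1 : (((lam * c ^ m : ℕ) : ℂ))⁻¹ / (c : ℂ) = (((lam * c ^ (m + 1) : ℕ) : ℂ))⁻¹ := by
    push_cast
    field_simp
    ring
  have e2 : (((lam * c ^ m : ℕ) : ℂ))⁻¹ / (c : ℂ) ^ 2 = (((lam * c ^ (m + 2) : ℕ) : ℂ))⁻¹ := by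
    push_cast
    field_simp
    ring
  have g0 : g (((lam * c ^ m : ℕ) : ℂ))⁻¹ = L₀ - α * ((lam * c ^ m : ℕ) : ℂ) - α₀ := by
    linear_combination h0
  have g1 : g (((lam * c ^ (m + 1) : ℕ) : ℂ))⁻¹ = L₁ - α * ((lam * c ^ (m + 1) : ℕ) : ℂ) - α₀ := by
    linear_combination h1
  have g2 : g (((lam * c ^ (m + 2) : ℕ) : ℂ))⁻¹ = L₂ - α * ((lam * c ^ (m + 2) : ℕ) : ℂ) - α₀ := by
    linear_combination h2
  simp only [geomSecondDiff]
  rw [e1, e2, g0, g1, g2]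
  push_cast
  ring

/-- **Step 1 (identity theorem): infinitely many geometric 3-progressions of hits kill `Ξ`.**
If for infinitely many `m` all three of `λcᵐ, λcᵐ⁺¹, λcᵐ⁺²` are hits of `αN + α₀ + g(1/N)`
(`g` analytic at `0`, `g 0 = 0`), then `Ξ_c g ≡ 0` near `0`. [folklore] -/
theorem geomSecondDiff_eventually_zero {c lam : ℕ} (hc : 2 ≤ c) (hlam : 1 ≤ lam) (α α₀ : ℂ)
    {g : ℂ → ℂ} (hg : AnalyticAt ℂ g 0) (hg0 : g 0 = 0)
    (hS : ∃ᶠ m : ℕ in atTop, ∀ r : ℕ, r ≤ 2 → ∃ L : ℤ,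
      α * ((lam * c ^ (m + r) : ℕ) : ℂ) + α₀ + g (((lam * c ^ (m + r) : ℕ) : ℂ))⁻¹ = L) :
    ∀ᶠ z in 𝓝 (0 : ℂ), geomSecondDiff (c : ℂ) g z = 0 := by
  set Ξ := geomSecondDiff (c : ℂ) g with hΞdef
  set t : ℕ → ℂ := fun m => (((lam * c ^ m : ℕ) : ℂ))⁻¹ with htdef
  have hΞan : AnalyticAt ℂ Ξ 0 := analyticAt_geomSecondDiff _ hg
  have ht : Tendsto t atTop (𝓝[≠] 0) := tendsto_inv_geometric hc hlam
  have ht0 : Tendsto t atTop (𝓝 0) := ht.mono_right nhdsWithin_le_nhds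
  -- `Ξ (t m) → 0`
  have hΞt : Tendsto (fun m => Ξ (t m)) atTop (𝓝 0) := by
    have h := hΞan.continuousAt.tendsto.comp ht0
    have hΞ0 : Ξ 0 = 0 := geomSecondDiff_zero _ hg0
    rw [hΞ0] at h
    exact h
  have hsmall : ∀ᶠ m in atTop, ‖Ξ (t m)‖ < 1 := by
    have h := hΞt.norm
    rw [norm_zero] at h
    exact h.eventually (gt_mem_nhds zero_lt_one)
  -- at every large triple hit, `Ξ (t m) = 0`
  have hzero : ∀ᶠ m : ℕ in atTop,
      (∀ r : ℕ, r ≤ 2 → ∃ L : ℤ,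
        α * ((lam * c ^ (m + r) : ℕ) : ℂ) + α₀ + g (((lam * c ^ (m + r) : ℕ) : ℂ))⁻¹ = L) →
      Ξ (t m) = 0 := by
    filter_upwards [hsmall] with m hm hhit
    obtain ⟨L₀, hL₀⟩ := hhit 0 (by norm_num)
    obtain ⟨L₁, hL₁⟩ := hhit 1 (by norm_num)
    obtain ⟨L₂, hL₂⟩ := hhit 2 (by norm_num)
    simp only [add_zero] at hL₀
    have hval : Ξ (t m) = (((c : ℤ) * L₀ - (1 + c) * L₁ + L₂ : ℤ) : ℂ) :=
      geomSecondDiff_sample_eq_int hc hlam α α₀ g m L₀ L₁ L₂ hL₀ hL₁ hL₂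
    have hlt : |((c : ℤ) * L₀ - (1 + c) * L₁ + L₂ : ℤ)| < 1 := by
      rw [hval, Complex.norm_intCast] at hm
      exact_mod_cast hm
    rw [hval, Int.abs_lt_one_iff.mp hlt, Int.cast_zero]
  have hfreq0 : ∃ᶠ z in 𝓝[≠] (0 : ℂ), Ξ z = 0 := ht.frequently (hS.mp hzero)
  exact hΞan.frequently_zero_iff_eventually_zero.mp hfreq0

/-- The impossible exponent identity: `c^{2n+1} + 1 ≠ cⁿ + c^{n+1}` for `c ≥ 2`, `n ≥ 1`.
[folklore] -/
theorem pow_identity_impossible {c n : ℕ} (hc : 2 ≤ c) (hn : 1 ≤ n) :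
    c ^ (2 * n + 1) + 1 ≠ c ^ n + c ^ (n + 1) := by
  have hX : 2 ≤ c ^ n := by
    calc 2 ≤ c := hc
      _ = c ^ 1 := (pow_one c).symm
      _ ≤ c ^ n := Nat.pow_le_pow_right (by omega) hn
  have e1 : c ^ (2 * n + 1) = c * (c ^ n * c ^ n) := by ring
  have e2 : c ^ (n + 1) = c * c ^ n := by ring
  rw [e1, e2]
  set X := c ^ n with hXdef
  have h1 : c * X * 2 ≤ c * X * X := Nat.mul_le_mul_left _ hX
  have h2 : 2 * X ≤ c * X := Nat.mul_le_mul_right _ hc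
  intro h
  nlinarith

/-- **Step 2: `Ξ_c g ≡ 0` near `0` forces `g ≡ 0` near `0`** (`c ≥ 2` an integer, `g 0 = 0`):
the first non-zero Taylor coefficient `n ≥ 1` of `g` would satisfy `c − (1 + c)c⁻ⁿ + c⁻²ⁿ = 0`.
[folklore] -/
theorem eventually_zero_of_geomSecondDiff_eventually_zero {c : ℕ} (hc : 2 ≤ c) {g : ℂ → ℂ}
    (hg : AnalyticAt ℂ g 0) (hg0 : g 0 = 0)
    (hΞ : ∀ᶠ z in 𝓝 (0 : ℂ), geomSecondDiff (c : ℂ) g z = 0) :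
    ∀ᶠ z in 𝓝 (0 : ℂ), g z = 0 := by
  by_contra hne
  obtain ⟨n, u, hu, hu0, hgu⟩ := hg.exists_eventuallyEq_pow_smul_nonzero_iff.mpr hne
  set B : ℂ := (c : ℂ) with hBdef
  have hB0 : B ≠ 0 := by rw [hBdef]; exact_mod_cast (show c ≠ 0 by omega)
  -- `n ≥ 1` because `g 0 = 0 ≠ u 0`
  have hn : 1 ≤ n := by
    rcases Nat.eq_zero_or_pos n with rfl | h
    · exfalso
      have h0 : g 0 = ((0 : ℂ) - 0) ^ 0 • u 0 := hgu.self_of_nhds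
      rw [pow_zero, one_smul, hg0] at h0
      exact hu0 h0.symm
    · exact h
  -- the normal form at the rescaled points
  have hdiv : ∀ d : ℂ, Tendsto (fun z : ℂ => z / d) (𝓝 0) (𝓝 0) := fun d => by
    simpa using ((continuous_id.div_const d).tendsto (0 : ℂ))
  have hgu1 : ∀ᶠ z in 𝓝 (0 : ℂ), g (z / B) = (z / B - 0) ^ n • u (z / B) := (hdiv B).eventually hgu
  have hgu2 : ∀ᶠ z in 𝓝 (0 : ℂ), g (z / B ^ 2) = (z / B ^ 2 - 0) ^ n • u (z / B ^ 2) :=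
    (hdiv (B ^ 2)).eventually hgu
  -- the bracket `W` with `Ξ z = zⁿ · W z`
  set W : ℂ → ℂ := fun z =>
    B * u z - (1 + B) * (B ^ n)⁻¹ * u (z / B) + (B ^ (2 * n))⁻¹ * u (z / B ^ 2) with hWdef
  have hBn : B ^ n ≠ 0 := pow_ne_zero _ hB0
  have hB2n : B ^ (2 * n) ≠ 0 := pow_ne_zero _ hB0
  have hfact : ∀ᶠ z in 𝓝 (0 : ℂ), geomSecondDiff B g z = z ^ n * W z := by
    filter_upwards [hgu, hgu1, hgu2] with z e0 e1 e2
    simp only [geomSecondDiff, e0, e1, e2, smul_eq_mul, sub_zero, hWdef]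
    have hp1 : (z / B) ^ n = z ^ n * (B ^ n)⁻¹ := by rw [div_pow, div_eq_mul_inv]
    have hp2 : (z / B ^ 2) ^ n = z ^ n * (B ^ (2 * n))⁻¹ := by
      rw [div_pow, div_eq_mul_inv, ← pow_mul, mul_comm 2 n]
    rw [hp1, hp2]
    ring
  -- hence `W = 0` on a punctured neighbourhood of `0`
  have hW : ∀ᶠ z in 𝓝[≠] (0 : ℂ), W z = 0 := by
    have h := hΞ.and hfact
    rw [eventually_nhdsWithin_iff]
    filter_upwards [h] with z hz hz0
    have h' : z ^ n * W z = 0 := by rw [← hz.2]; exact hz.1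
    exact (mul_eq_zero.mp h').resolve_left (pow_ne_zero _ hz0)
  -- `W` is continuous at `0`, so `W 0 = 0`
  have hWan : AnalyticAt ℂ W 0 := by
    have hu1 : AnalyticAt ℂ (fun z => u (z / B)) 0 := analyticAt_comp_div_const hu B
    have hu2 : AnalyticAt ℂ (fun z => u (z / B ^ 2)) 0 := analyticAt_comp_div_const hu (B ^ 2)
    exact ((analyticAt_const.mul hu).sub (analyticAt_const.mul hu1)).add (analyticAt_const.mul hu2)
  have hW0 : W 0 = 0 := by
    have t1 : Tendsto W (𝓝[≠] 0) (𝓝 (W 0)) := hWan.continuousAt.tendsto.mono_left nhdsWithin_le_nhds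
    have t2 : Tendsto W (𝓝[≠] 0) (𝓝 0) :=
      tendsto_const_nhds.congr' (hW.mono fun z hz => hz.symm)
    exact tendsto_nhds_unique t1 t2
  have hW0' : W 0 = u 0 * (B - (1 + B) * (B ^ n)⁻¹ + (B ^ (2 * n))⁻¹) := by
    simp only [hWdef, zero_div]
    ring
  have hcoef : B - (1 + B) * (B ^ n)⁻¹ + (B ^ (2 * n))⁻¹ = 0 := by
    have h := hW0
    rw [hW0'] at h
    exact (mul_eq_zero.mp h).resolve_left hu0
  -- clear denominators: `B^{2n+1} + 1 = Bⁿ + B^{n+1}`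
  have key : B ^ (2 * n + 1) + 1 = B ^ n + B ^ (n + 1) := by
    have h1 : B ^ (2 * n) * (B ^ n)⁻¹ = B ^ n := by
      rw [two_mul, pow_add, mul_assoc, mul_inv_cancel₀ hBn, mul_one]
    have h2 : B ^ (2 * n) * (B ^ (2 * n))⁻¹ = 1 := mul_inv_cancel₀ hB2n
    have h3 := congrArg (fun x => B ^ (2 * n) * x) hcoef
    simp only [mul_zero] at h3
    have h4 : B ^ (2 * n) * (B - (1 + B) * (B ^ n)⁻¹ + (B ^ (2 * n))⁻¹) =
        B ^ (2 * n) * B - (1 + B) * (B ^ (2 * n) * (B ^ n)⁻¹) + B ^ (2 * n) * (B ^ (2 * n))⁻¹ := by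
      ring
    rw [h4, h1, h2] at h3
    linear_combination h3
  -- cast down to `ℕ`
  have keyN : c ^ (2 * n + 1) + 1 = c ^ n + c ^ (n + 1) := by
    rw [hBdef] at key
    exact_mod_cast key
  exact pow_identity_impossible hc hn keyN

/-- **Rigidity of cusp hits on geometric abscissae.** Let `c ≥ 2`, `λ ≥ 1` be integers,
`α, α₀ ∈ ℂ` any linear jet, and `g` analytic at `0` with `g 0 = 0`. If for infinitely many `m` the
three numbers `λcᵐ, λcᵐ⁺¹, λcᵐ⁺²` are all hits (`αN + α₀ + g(1/N) ∈ ℤ`), then `g ≡ 0` near `0`.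
Equivalently: a non-zero tail admits only finitely many such geometric 3-progressions of hits; with
`c = bᵖ`, `λ = bˢ` the exponent set `{m : bᵐ hit}` contains only finitely many 3-term arithmetic
progressions of each common difference `p` (hence, by Roth's theorem, has upper density `0`).
[folklore] -/
theorem eventually_zero_of_frequently_geometric_hits {c lam : ℕ} (hc : 2 ≤ c) (hlam : 1 ≤ lam)
    (α α₀ : ℂ) {g : ℂ → ℂ} (hg : AnalyticAt ℂ g 0) (hg0 : g 0 = 0)
    (hS : ∃ᶠ m : ℕ in atTop, ∀ r : ℕ, r ≤ 2 → ∃ L : ℤ,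
      α * ((lam * c ^ (m + r) : ℕ) : ℂ) + α₀ + g (((lam * c ^ (m + r) : ℕ) : ℂ))⁻¹ = L) :
    ∀ᶠ z in 𝓝 (0 : ℂ), g z = 0 :=
  eventually_zero_of_geomSecondDiff_eventually_zero hc hg hg0
    (geomSecondDiff_eventually_zero hc hlam α α₀ hg hg0 hS)

/-- Contrapositive, "no structured counterexample" form: a tail that is NOT identically zero near `0`
has, along every geometric progression `λ·cᵐ`, only finitely many `m` with `λcᵐ, λcᵐ⁺¹, λcᵐ⁺²`
all hits. [folklore] -/
theorem geometric_triple_hits_eventually_fail {c lam : ℕ} (hc : 2 ≤ c) (hlam : 1 ≤ lam)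
    (α α₀ : ℂ) {g : ℂ → ℂ} (hg : AnalyticAt ℂ g 0) (hg0 : g 0 = 0)
    (hne : ¬ ∀ᶠ z in 𝓝 (0 : ℂ), g z = 0) :
    ∀ᶠ m : ℕ in atTop, ∃ r : ℕ, r ≤ 2 ∧ ∀ L : ℤ,
      α * ((lam * c ^ (m + r) : ℕ) : ℂ) + α₀ + g (((lam * c ^ (m + r) : ℕ) : ℂ))⁻¹ ≠ L := by
  by_contra h
  rw [not_eventually] at h
  refine hne (eventually_zero_of_frequently_geometric_hits hc hlam α α₀ hg hg0 ?_)
  refine h.mono fun m hm => ?_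
  intro r hr
  by_contra hL
  exact hm ⟨r, hr, fun L hL' => hL ⟨L, hL'⟩⟩

end

end Literature.NumberTheory.Transcendental
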